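import Summits.CriticalPhenomena.PercolationContinuityZ3.Theorems.PercNearOneGluingNoHeavyLowerTailSahiClassTSingleCube
import Summits.CriticalPhenomena.PercolationContinuityZ3.Theorems.PercNearOneGluingNoHeavyLowerTailSahiClassTLambdaTwoCubes
import Summits.CriticalPhenomena.PercolationContinuityZ3.Theorems.PercNearOneGluingNoHeavyLowerTailSahiC3CombCube
import Mathlib.Tactic.Linarith
import Mathlib.Tactic.Ring
import HarnessLib

/-!
# `NoHeavyLowerTail` (crux stmt-CriticalPhenomena-4575), P2 — class T on a single cube, II: **the λ = 2 rung / BGC at EVERY coordinate**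
# of every triple of increasing events with no coordinate essential to all three

Support file (seat `prim-masterthm-p2`, gen 14; `--supports stmt-CriticalPhenomena-4575`).  No definition, no `sorry`, standard axioms.
Companion of `…SahiClassTSingleCube` (the `glue3` bridge and `C_3` on class T) and `…SahiClassTLambdaTwoCubes` (the three-block λ = 2 theorem).

* `sq_mul_sahiE_three_add_le_of_blocks` — block form: if `U₀` is unaffected by block `2`, `U₁` by block `1`, `U₂` by block `0` of a labelling
  `blk : κ → Fin 3`, then at every coordinate `e` of block `0` (shared by `U₀, U₁` only)
  `p_e²·E_3(μ_{p[e↦1]}; 1_U) + (1−p_e)²·E_3(μ_{p[e↦0]}; 1_U) ≤ E_3(μ_p; 1_U)`.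
* **`sq_mul_sahiE_three_add_le_of_classT`** — for increasing `U₀, U₁, U₂ ⊆ 2^κ` with `∀ x, ¬(x ∈ esupp U₀ ∧ x ∈ esupp U₁ ∧ x ∈ esupp U₂)`
  (`SahiHybrid.IsClassT`), EVERY `p` and EVERY coordinate `e`:
  `p_e²·E_3(μ_{p[e↦1]}) + (1−p_e)²·E_3(μ_{p[e↦0]}) ≤ E_3(μ_p)` (the three blocks by the symmetry of `E_3`: `SahiC3CombCube.sahiE_three_swap23`, `sahiE_three_rotate`).
  Since the fibre `s ↦ E_3(μ_{p[e↦s]})` of a class-T triple is at most QUADRATIC in `s` (no member… at most two members depend on `e`), this is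
  `β₁(e) ≥ 0`: master-conj's BGC (`B₁, B₂ ≥ 0`), the λ = 2 forms MC1 `3B₁ ≥ B₀` / MC2 `3B₂ ≥ B₃` and bnk-2's `SahiTwoLevelMinus/Plus` at the
  sections `(U^{e←1}, U^{e←0})` hold at EVERY coordinate of EVERY class-T triple, for every product measure.
* `sq_mul_sahiE_three_one_le_of_classT` (`p_e²·E_3(μ_{p[e↦1]}) ≤ E_3(μ_p)`), `sq_mul_sahiE_three_zero_le_of_classT`.
HONEST FRAMING: off class T (a coordinate essential to all three members), BGC-all / `SahiTwoLevelPlus` / `C_3` remain OPEN. [this work]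
-/

noncomputable section

open scoped Classical

namespace Summit.CriticalPhenomena.PercolationContinuityZ3.Theorems

namespace SahiClassTCube

open Finset Function
open Literature.Combinatorics.Sahi2008
open Literature.Probability.Percolation (DeterminedBy determinedBy_iff)
open Literature.Probability.Percolation.DecisionTree (ind ind_of_mem ind_of_not_mem ind_nonneg)

variable {κ : Type} [Fintype κ]

/-- `E₃` is invariant under the cyclic shift of its slots (every weight). [cite: LiebSahi2021, Def. 3.1 (symmetry of `E_n`)] -/
theorem sahiE_three_rotate {α : Type*} [Fintype α] (μ : α → ℝ) (f g h : α → ℝ) :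
    sahiE μ 3 ![g, h, f] = sahiE μ 3 ![f, g, h] := by
  rw [sahiE_three, sahiE_three, show g * h * f = f * g * h by ring, show h * f = f * h by ring, show g * f = f * g by ring]
  ring

section Blocks

variable (blk : κ → Fin 3) {U₀ U₁ U₂ : Set (Set κ)}

/-- **λ = 2 / BGC, block form.**  If `U₀` is unaffected by block `2`, `U₁` by block `1` and `U₂` by block `0`, then at every coordinate `e`
of block `0`:  `p_e²·E_3(μ_{p[e↦1]}; 1_U) + (1−p_e)²·E_3(μ_{p[e↦0]}; 1_U) ≤ E_3(μ_p; 1_U)`. [this work] -/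
theorem sq_mul_sahiE_three_add_le_of_blocks (hU₀ : IsUpperSet U₀) (hU₁ : IsUpperSet U₁) (hU₂ : IsUpperSet U₂)
    (h₀ : DeterminedBy U₀ {x | blk x ≠ 2}) (h₁ : DeterminedBy U₁ {x | blk x ≠ 1}) (h₂ : DeterminedBy U₂ {x | blk x ≠ 0})
    (p : κ → unitInterval) {e : κ} (he : blk e = 0) :
    (p e : ℝ) ^ 2 * sahiE (bernoulliWeight (update p e 1)) 3 ![ind U₀, ind U₁, ind U₂] +
      (1 - (p e : ℝ)) ^ 2 * sahiE (bernoulliWeight (update p e 0)) 3 ![ind U₀, ind U₁, ind U₂] ≤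
      sahiE (bernoulliWeight p) 3 ![ind U₀, ind U₁, ind U₂] := by
  rw [sahiE_three_ind_eq_blocks blk U₀ U₁ U₂ (update p e 1) h₀ h₁ h₂, sahiE_three_ind_eq_blocks blk U₀ U₁ U₂ (update p e 0) h₀ h₁ h₂,
    sahiE_three_ind_eq_blocks blk U₀ U₁ U₂ p h₀ h₁ h₂]
  -- the block parameters of the updated `p`
  have hA : ∀ s : unitInterval, (fun a : {x // blk x = 1} => update p e s a.1) = fun a => p a.1 := fun s => by
    funext a
    have : a.1 ≠ e := fun h => by have := a.2; rw [h, he] at this; exact absurd this (by decide)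
    exact update_of_ne this s p
  have hB : ∀ s : unitInterval, (fun b : {x // blk x = 2} => update p e s b.1) = fun b => p b.1 := fun s => by
    funext b
    have : b.1 ≠ e := fun h => by have := b.2; rw [h, he] at this; exact absurd this (by decide)
    exact update_of_ne this s p
  have hC : ∀ s : unitInterval, (fun c : {x // blk x = 0} => update p e s c.1) =
      update (fun c : {x // blk x = 0} => p c.1) ⟨e, he⟩ s := fun s => by
    funext c
    by_cases hc : c = ⟨e, he⟩
    · subst hc; simp
    · have : c.1 ≠ e := fun h => hc (Subtype.ext h)
      rw [update_of_ne hc, update_of_ne this]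
  rw [hA, hB, hC, hA, hB, hC]
  have key := SahiClassTLambdaTwo.sq_mul_sahiE_three_add_le_cubes (fun a : {x // blk x = 1} => p a.1) (fun b : {x // blk x = 2} => p b.1)
    (fun c : {x // blk x = 0} => p c.1) (fun c a => ind U₀ (glue3 blk (a, ∅, c))) (fun c b => ind U₁ (glue3 blk (∅, b, c)))
    (fun a b => ind U₂ (glue3 blk (a, b, ∅)))
    (fun c a => ind_nonneg _ _) (fun c a a' haa => monotone_ind_of_isUpperSet hU₀ (glue3_mono blk haa le_rfl le_rfl))
    (fun a c c' hcc => monotone_ind_of_isUpperSet hU₀ (glue3_mono blk le_rfl le_rfl hcc))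
    (fun c b => ind_nonneg _ _) (fun c b b' hbb => monotone_ind_of_isUpperSet hU₁ (glue3_mono blk le_rfl hbb le_rfl))
    (fun b c c' hcc => monotone_ind_of_isUpperSet hU₁ (glue3_mono blk le_rfl le_rfl hcc))
    (fun a b => ind_nonneg _ _) (fun b a a' haa => monotone_ind_of_isUpperSet hU₂ (glue3_mono blk haa le_rfl le_rfl))
    (fun a b b' hbb => monotone_ind_of_isUpperSet hU₂ (glue3_mono blk le_rfl hbb le_rfl)) ⟨e, he⟩
  -- (`convert`, not `exact`: the `Fintype`/`Decidable` instances on the block cubes are subsingleton-equal, not syntactically equal)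
  convert key

end Blocks

section ClassT

variable {U₀ U₁ U₂ : Set (Set κ)}

/-- **THEOREM (λ = 2 / BGC AT EVERY COORDINATE OF A CLASS-T TRIPLE, single cube).**  For increasing events `U₀, U₁, U₂ ⊆ 2^κ` with no coordinate
essential to all three, every product measure `μ_p` and EVERY coordinate `e`:
  `p_e²·E_3(μ_{p[e↦1]}; 1_{U₀},1_{U₁},1_{U₂}) + (1−p_e)²·E_3(μ_{p[e↦0]}; …) ≤ E_3(μ_p; …)`.
(`e` lies in one of the three blocks `C = esupp U₀ ∩ esupp U₁`, `A = esupp U₀ ∖ esupp U₁`, `B = (esupp U₀)ᶜ`; apply the block theorem to the suitably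
permuted triple and undo the permutation by the symmetry of `E_3`.) [this work] -/
theorem sq_mul_sahiE_three_add_le_of_classT (hU₀ : IsUpperSet U₀) (hU₁ : IsUpperSet U₁) (hU₂ : IsUpperSet U₂)
    (hT : ∀ x, ¬ (x ∈ esupp U₀ ∧ x ∈ esupp U₁ ∧ x ∈ esupp U₂)) (p : κ → unitInterval) (e : κ) :
    (p e : ℝ) ^ 2 * sahiE (bernoulliWeight (update p e 1)) 3 ![ind U₀, ind U₁, ind U₂] +
      (1 - (p e : ℝ)) ^ 2 * sahiE (bernoulliWeight (update p e 0)) 3 ![ind U₀, ind U₁, ind U₂] ≤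
      sahiE (bernoulliWeight p) 3 ![ind U₀, ind U₁, ind U₂] := by
  have d₀ := determinedBy_esupp hU₀
  have d₁ := determinedBy_esupp hU₁
  have d₂ := determinedBy_esupp hU₂
  by_cases he₀ : e ∈ esupp U₀
  · by_cases he₁ : e ∈ esupp U₁
    · -- `e` in block `C` (shared by `U₀, U₁`; not essential to `U₂` by class T): labelling `C ↦ 0`, `A ↦ 1`, `B ↦ 2`
      let blk : κ → Fin 3 := fun x => if x ∈ esupp U₀ then (if x ∈ esupp U₁ then 0 else 1) else 2
      have he : blk e = 0 := by simp only [blk, he₀, he₁, if_true]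
      refine sq_mul_sahiE_three_add_le_of_blocks blk hU₀ hU₁ hU₂ ?_ ?_ ?_ p he
      · refine d₀.mono fun x hx => ?_
        have hx' : x ∈ esupp U₀ := hx
        simp only [Set.mem_setOf_eq, blk, hx', if_true]
        split_ifs <;> decide
      · refine d₁.mono fun x hx => ?_
        have hx' : x ∈ esupp U₁ := hx
        simp only [Set.mem_setOf_eq, blk, hx', if_true]
        split_ifs <;> decide
      · refine d₂.mono fun x hx => ?_
        have hx' : x ∈ esupp U₂ := hx
        simp only [Set.mem_setOf_eq, blk]
        by_cases h0 : x ∈ esupp U₀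
        · by_cases h1 : x ∈ esupp U₁
          · exact absurd ⟨h0, h1, hx'⟩ (hT x)
          · simp only [h0, h1, if_true, if_false]; decide
        · simp only [h0, if_false]; decide
    · -- `e` in block `A` (`U₀` and possibly `U₂`, not `U₁`): use the triple `(U₀, U₂, U₁)` with labelling `A ↦ 0`, `C ↦ 1`, `B ↦ 2`
      let blk : κ → Fin 3 := fun x => if x ∈ esupp U₀ then (if x ∈ esupp U₁ then 1 else 0) else 2
      have he : blk e = 0 := by simp only [blk, he₀, he₁, if_true, if_false]
      have key := sq_mul_sahiE_three_add_le_of_blocks blk hU₀ hU₂ hU₁ ?_ ?_ ?_ p he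
      · rw [SahiC3CombCube.sahiE_three_swap23 _ (ind U₀) (ind U₂) (ind U₁), SahiC3CombCube.sahiE_three_swap23 _ (ind U₀) (ind U₂) (ind U₁),
          SahiC3CombCube.sahiE_three_swap23 _ (ind U₀) (ind U₂) (ind U₁)] at key
        exact key
      · refine d₀.mono fun x hx => ?_
        have hx' : x ∈ esupp U₀ := hx
        simp only [Set.mem_setOf_eq, blk, hx', if_true]
        split_ifs <;> decide
      · -- `U₂` unaffected by block `1` (= `C = esupp U₀ ∩ esupp U₁`, class T)
        refine d₂.mono fun x hx => ?_
        have hx' : x ∈ esupp U₂ := hx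
        simp only [Set.mem_setOf_eq, blk]
        by_cases h0 : x ∈ esupp U₀
        · by_cases h1 : x ∈ esupp U₁
          · exact absurd ⟨h0, h1, hx'⟩ (hT x)
          · simp only [h0, h1, if_true, if_false]; decide
        · simp only [h0, if_false]; decide
      · -- `U₁` unaffected by block `0` (= `A`)
        refine d₁.mono fun x hx => ?_
        have hx' : x ∈ esupp U₁ := hx
        simp only [Set.mem_setOf_eq, blk, hx', if_true]
        split_ifs <;> decide
  · -- `e` in block `B` (not essential to `U₀`): use the triple `(U₁, U₂, U₀)` with labelling `B ↦ 0`, `C ↦ 1`, `A ↦ 2`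
    let blk : κ → Fin 3 := fun x => if x ∈ esupp U₀ then (if x ∈ esupp U₁ then 1 else 2) else 0
    have he : blk e = 0 := by simp only [blk, he₀, if_false]
    have key := sq_mul_sahiE_three_add_le_of_blocks blk hU₁ hU₂ hU₀ ?_ ?_ ?_ p he
    · rw [sahiE_three_rotate _ (ind U₀) (ind U₁) (ind U₂), sahiE_three_rotate _ (ind U₀) (ind U₁) (ind U₂),
        sahiE_three_rotate _ (ind U₀) (ind U₁) (ind U₂)] at key
      exact key
    · -- `U₁` unaffected by block `2` (= `A = esupp U₀ ∖ esupp U₁`)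
      refine d₁.mono fun x hx => ?_
      have hx' : x ∈ esupp U₁ := hx
      simp only [Set.mem_setOf_eq, blk, hx', if_true]
      split_ifs <;> decide
    · -- `U₂` unaffected by block `1` (= `C`)
      refine d₂.mono fun x hx => ?_
      have hx' : x ∈ esupp U₂ := hx
      simp only [Set.mem_setOf_eq, blk]
      by_cases h0 : x ∈ esupp U₀
      · by_cases h1 : x ∈ esupp U₁
        · exact absurd ⟨h0, h1, hx'⟩ (hT x)
        · simp only [h0, h1, if_true, if_false]; decide
      · simp only [h0, if_false]; decide
    · -- `U₀` unaffected by block `0` (= `B = (esupp U₀)ᶜ`)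
      refine d₀.mono fun x hx => ?_
      have hx' : x ∈ esupp U₀ := hx
      simp only [Set.mem_setOf_eq, blk, hx', if_true]
      split_ifs <;> decide

/-- **λ = 2, top form, on class T**: `p_e²·E_3(μ_{p[e↦1]}) ≤ E_3(μ_p)` at every coordinate. [this work] -/
theorem sq_mul_sahiE_three_one_le_of_classT (hU₀ : IsUpperSet U₀) (hU₁ : IsUpperSet U₁) (hU₂ : IsUpperSet U₂)
    (hT : ∀ x, ¬ (x ∈ esupp U₀ ∧ x ∈ esupp U₁ ∧ x ∈ esupp U₂)) (p : κ → unitInterval) (e : κ) :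
    (p e : ℝ) ^ 2 * sahiE (bernoulliWeight (update p e 1)) 3 ![ind U₀, ind U₁, ind U₂] ≤
      sahiE (bernoulliWeight p) 3 ![ind U₀, ind U₁, ind U₂] := by
  have h3 := sq_mul_sahiE_three_add_le_of_classT hU₀ hU₁ hU₂ hT p e
  have h0 := sahiE_three_nonneg_of_classT hU₀ hU₁ hU₂ hT (update p e 0)
  nlinarith [sq_nonneg (1 - (p e : ℝ))]

/-- **λ = 2, bottom form, on class T**: `(1−p_e)²·E_3(μ_{p[e↦0]}) ≤ E_3(μ_p)` at every coordinate. [this work] -/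
theorem sq_mul_sahiE_three_zero_le_of_classT (hU₀ : IsUpperSet U₀) (hU₁ : IsUpperSet U₁) (hU₂ : IsUpperSet U₂)
    (hT : ∀ x, ¬ (x ∈ esupp U₀ ∧ x ∈ esupp U₁ ∧ x ∈ esupp U₂)) (p : κ → unitInterval) (e : κ) :
    (1 - (p e : ℝ)) ^ 2 * sahiE (bernoulliWeight (update p e 0)) 3 ![ind U₀, ind U₁, ind U₂] ≤
      sahiE (bernoulliWeight p) 3 ![ind U₀, ind U₁, ind U₂] := by
  have h3 := sq_mul_sahiE_three_add_le_of_classT hU₀ hU₁ hU₂ hT p e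
  have h1 := sahiE_three_nonneg_of_classT hU₀ hU₁ hU₂ hT (update p e 1)
  nlinarith [sq_nonneg (p e : ℝ)]

end ClassT

end SahiClassTCube

end Summit.CriticalPhenomena.PercolationContinuityZ3.Theorems
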